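import Summits.QuantumFields.BalabanUV.Gaps.CapTailSlopeSandwich

/-!
# Gaps / CapSignsNecessaryFine — the necessity series under the FINE-LATTICE reading of [I] (0.31): what survives when Theorem 2 is read
# «for all lattices `K ≥ K₀`» instead of the typed ∀-K statement (cell pub-balaban-gaps, seat g1-p3 gen 3, CAP+tail «split ∕ weakening» charge;
# fifth file of the series `CapSignsNecessary` ∕ `CapFloorNotNecessary` ∕ `CapTailLimitNecessary` ∕ `CapTailSlopeSandwich` ∕ this one)

HONEST FRAMING (cell rule, page 1 of everything): bookkeeping over the β sub-cell's hypothesis carriers; NOTHING of Bałaban's is asserted beyond print;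
[Balaban1987RG1] Thm 2 is UNPROVED IN PRINT; here a WEAKER, fine-lattice reading of its (0.31) clause is a HYPOTHESIS stated inline (no new
definition); 0 binders discharged; NOT `BetaPertH`, NOT the continuum limit, NOT Clay.  HONEST DEPENDENCY (b2b cell, verbatim): «continuum YM on T⁴ ⇐
BetaPertH ∧ nine spine estimates (0/9 proved); BetaPertH ⇐ (D1) ∧ (D4) ∧ CAP+tail; G-an2-4 gates asym, D1 and NE2/3/4.»

WHY.  `CapSignsNecessary` (N1) reads the lower half of (0.31) on the COARSE lattice `K = k+1` of the typed ∀-K statement `B12.Thm2Printed`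
(as `Beta.PrefixAbsorption` §4 does at `k = 0`); the print («for a sufficiently small positive g there exists g₀(ε, g)», ε = L^{−K}) is typed with
every `K`, but a reader may prefer (0.31) only on FINE lattices `K ≥ K₀` (K₀ after g, like β, β′).  This file records what the series keeps under
that reading — everything on the TAIL side, and (N1) asymptotically:
§1 the fine clause (inline): `∀ K ≥ K₀, ∃ g₀: run in ]0,γ], g_K = g, history recursion, two-sided (0.31) with b, β′`; `fineRuns_of_thm2Printed`
   (the typed statement gives it with `K₀ = 0`); window bookkeeping for windows ENDING at `K ≥ K₀`: `beta0_windowSum_ge_fine` ∕ `_le_fine`.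
§2 consequences at fixed data (remainder bounded by `R` on the run's box, `EverySlope`, `L > 1`): `late_boxPoint_ge_fine` (every LATE `β_{k+1}`,
   `k + 1 ≥ K₀`, is `≥ b·log L` at a realised history); `beta0_ge_late_fine` ((N1) asymptotically: `β⁰_{k+1} ≥ b log L − s` for `k + 1 ≥ K₀`
   when the run's box lies in the `s`-box of `EverySlope`); `partialSums_unbounded_fine`; `abelian_not_fine` (cap3's abelian β⁰ admits NO fine-lattice
   (0.31) either); `le_lim_of_partialSum_lower_tendsto` ∕ `lim_le_of_partialSum_upper_tendsto` (Cesàro with a threshold `n ≥ n₁`) ⟹ **`slope_sandwich_binf_fine`**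
   (`b·log L ≤ β⁰_∞ ≤ β′·log L`) and `eventualFloor_fine_tendsto` (convergent β⁰ ⟹ `0 < β⁰_∞` and an eventual floor).
So the reading caveat of `CapSignsNecessary` touches ONLY «`0 ≤ β⁰_{k+1}` at each fixed EARLY `k`»: the early CAP signs are necessary for the typed
∀-K statement, while the tail-side necessities ((N2) for late windows, the abelian negative, the socket∕convergence floors, the sandwich) hold under
either reading.  All [folklore] real-sequence bookkeeping; 0 sorry; 0 def; imports `Gaps.CapTailSlopeSandwich`; restates nothing.
-/

namespace Summit.QuantumFields.BalabanUV.Gaps.CapSignsNecessaryFine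

open Literature.MathematicalPhysics.QuantumFieldTheory.Balaban1983to89
open Literature.MathematicalPhysics.QuantumFieldTheory.Balaban1983to89.FlowStep
open Literature.MathematicalPhysics.QuantumFieldTheory.Balaban1983to89.FlowStepRuns
open Literature.MathematicalPhysics.QuantumFieldTheory.Balaban1983to89.DagBinding
open Literature.MathematicalPhysics.QuantumFieldTheory.Balaban1983to89.Beta.RemainderChain (RemainderConst)
open Summit.QuantumFields.BalabanUV.Gaps.CapSignsConstRoad (EverySlope)
open Summit.QuantumFields.BalabanUV.Gaps.CapSignsNecessary
open Summit.QuantumFields.BalabanUV.Gaps.CapTailLimitNecessary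
open Summit.QuantumFields.BalabanUV.Gaps.CapTailSlopeSandwich
open Filter
open scoped Topology

noncomputable section

variable {β : HBeta}

/-! ## §1 The fine-lattice clause and its window bookkeeping -/

/-- The typed ∀-K statement gives the fine clause with `K₀ = 0` (and the history recursion): sanity ∕ comparison. [cite: Balaban1987RG1, Thm 2 (0.31) p.259] -/
theorem fineRuns_of_thm2Printed {C : B12.Construction} (hgen : ForwardGenerated C β) (hhalt : HaltsOutside C β)
    (hcur : CurriesHBeta C β) {L : ℝ} (h : B12.Thm2Printed C L) (m : ℕ) :
    ∃ γ₂ : ℝ, 0 < γ₂ ∧ ∀ γ : ℝ, 0 < γ → γ ≤ γ₂ → ∃ gstar : ℝ, 0 < gstar ∧ ∀ g : ℝ, 0 < g → g ≤ gstar →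
      ∃ b β' : ℝ, ∃ K₀ : ℕ, 0 < b ∧ b ≤ β' ∧ ∀ K : ℕ, K₀ ≤ K → ∃ g0 : ℝ,
        (C ⟨K, m, g0⟩).flow.InInterval γ K ∧ (C ⟨K, m, g0⟩).flow.g K = g ∧ RGEqH K β (C ⟨K, m, g0⟩).flow.g ∧
        ∀ k, k ≤ K →
          1 / g ^ 2 + b * (((K : ℝ) - k) * Real.log L) ≤ 1 / ((C ⟨K, m, g0⟩).flow.g k) ^ 2 ∧
          1 / ((C ⟨K, m, g0⟩).flow.g k) ^ 2 ≤ 1 / g ^ 2 + β' * (((K : ℝ) - k) * Real.log L) := by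
  obtain ⟨γ₂, hγ₂, hγ⟩ := runs_of_thm2Printed hgen hhalt hcur h m
  refine ⟨γ₂, hγ₂, fun γ hγ0 hγle => ?_⟩
  obtain ⟨gstar, hgstar, hg⟩ := hγ γ hγ0 hγle
  refine ⟨gstar, hgstar, fun g hg0 hgle => ?_⟩
  obtain ⟨b, β', hb, hbβ', hK⟩ := hg g hg0 hgle
  exact ⟨b, β', 0, hb, hbβ', fun K _ => hK K⟩

section FixedData

variable (S : B12Beta.OneLoopSplit β) {C : B12.Construction} {m K₀ : ℕ} {γ γc g b β' L R binf : ℝ}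

/-- **LATE SCALES ARE POSITIVE SOMEWHERE** under the fine clause: for every `k` with `K₀ ≤ k + 1`, the realised history of the lattice `K = k+1`
gives `v ∈ ]0,γ]^{k+1}` with `b·log L ≤ β_{k+1}(v)`. [cite: Balaban1987RG1, Thm 2 (0.31) p.259] -/
theorem late_boxPoint_ge_fine
    (hK : ∀ K : ℕ, K₀ ≤ K → ∃ g0 : ℝ, (C ⟨K, m, g0⟩).flow.InInterval γ K ∧ (C ⟨K, m, g0⟩).flow.g K = g ∧
      RGEqH K β (C ⟨K, m, g0⟩).flow.g ∧ ∀ k, k ≤ K →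
        1 / g ^ 2 + b * (((K : ℝ) - k) * Real.log L) ≤ 1 / ((C ⟨K, m, g0⟩).flow.g k) ^ 2 ∧
        1 / ((C ⟨K, m, g0⟩).flow.g k) ^ 2 ≤ 1 / g ^ 2 + β' * (((K : ℝ) - k) * Real.log L))
    {k : ℕ} (hk : K₀ ≤ k + 1) : ∃ v ∈ Box γ k, b * Real.log L ≤ β k v := by
  obtain ⟨g0, hI, hend, hrg, hbounds⟩ := hK (k + 1) hk
  refine ⟨prefixOf (C ⟨k + 1, m, g0⟩).flow.g k, mem_box.mpr fun i => hI i (by omega), ?_⟩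
  have hw := windowSum_ge_of_run hrg hend (fun j hj => (hbounds j hj).1) (Nat.le_succ k)
  rw [Finset.sum_Ico_succ_top le_rfl, Finset.Ico_self, Finset.sum_empty, zero_add] at hw
  have e : (((k + 1 : ℕ) : ℝ) - k) * Real.log L = Real.log L := by push_cast; ring
  rw [e] at hw
  exact hw

/-- **(N1) ASYMPTOTICALLY** under the fine clause: if the run's box lies inside a box where the remainder is `≤ s`, then every late one-loop
coefficient satisfies `b·log L − s ≤ β⁰_{k+1}` (`K₀ ≤ k + 1`).  With `EverySlope` (s arbitrary, box after s) this is `lim inf β⁰ ≥ 0`, and indeed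
`≥ b log L − s` eventually — the fine-lattice form of `CapSignsNecessary.beta0_nonneg_of_thm2Printed`. [cite: Balaban1987RG1, Thm 2 (0.31) p.259] -/
theorem beta0_ge_late_fine {s : ℝ} (hs : RemainderConst S γ s)
    (hK : ∀ K : ℕ, K₀ ≤ K → ∃ g0 : ℝ, (C ⟨K, m, g0⟩).flow.InInterval γ K ∧ (C ⟨K, m, g0⟩).flow.g K = g ∧
      RGEqH K β (C ⟨K, m, g0⟩).flow.g ∧ ∀ k, k ≤ K →
        1 / g ^ 2 + b * (((K : ℝ) - k) * Real.log L) ≤ 1 / ((C ⟨K, m, g0⟩).flow.g k) ^ 2 ∧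
        1 / ((C ⟨K, m, g0⟩).flow.g k) ^ 2 ≤ 1 / g ^ 2 + β' * (((K : ℝ) - k) * Real.log L))
    {k : ℕ} (hk : K₀ ≤ k + 1) : b * Real.log L - s ≤ S.β0 k := by
  obtain ⟨v, hv, hbv⟩ := late_boxPoint_ge_fine hK hk
  have hvs : v ∈ B12Beta.HistBox γ k := fun i => mem_box.mp hv i
  have h1 := (abs_le.mp (hs k v hvs)).2
  rw [S.split k v] at hbv
  linarith

/-- Window bookkeeping for windows ENDING AT `K ≥ K₀` (lower side): `(c − s)·n − R·N₀ ≤ Σ_{[k,k+n)} β⁰` whenever `K₀ ≤ k + n`, where `c = b·log L`,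
`|β¹| ≤ R` on the run's box and `≤ s` on a small box `]0,γₛ]` with `1 ≤ c·N₀·γₛ²` (`CapSignsNecessary.beta0_windowSum_ge_of_run`). [folklore] -/
theorem beta0_windowSum_ge_fine {γs s : ℝ} {N₀ : ℕ} (hg : 0 < g) (hc : 0 < b * Real.log L)
    (hR : RemainderConst S γ R) (hs : RemainderConst S γs s) (hγs : 0 < γs) (hN₀ : 1 ≤ b * Real.log L * N₀ * γs ^ 2)
    (hK : ∀ K : ℕ, K₀ ≤ K → ∃ g0 : ℝ, (C ⟨K, m, g0⟩).flow.InInterval γ K ∧ (C ⟨K, m, g0⟩).flow.g K = g ∧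
      RGEqH K β (C ⟨K, m, g0⟩).flow.g ∧ ∀ k, k ≤ K →
        1 / g ^ 2 + b * (((K : ℝ) - k) * Real.log L) ≤ 1 / ((C ⟨K, m, g0⟩).flow.g k) ^ 2 ∧
        1 / ((C ⟨K, m, g0⟩).flow.g k) ^ 2 ≤ 1 / g ^ 2 + β' * (((K : ℝ) - k) * Real.log L))
    {k n : ℕ} (hkn : K₀ ≤ k + n) :
    (b * Real.log L - s) * n - R * N₀ ≤ ∑ j ∈ Finset.Ico k (k + n), S.β0 j := by
  obtain ⟨g0, hI, hend, hrg, hbounds⟩ := hK (k + n) hkn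
  have hw := beta0_windowSum_ge_of_run S hc hrg hend hg hI hR hs hγs hN₀
    (fun j hj => by have := (hbounds j hj).1; linarith) (Nat.le_add_right k n)
  have e : (((k + n : ℕ) : ℝ) - k) = n := by push_cast; ring
  rw [e] at hw
  exact hw

/-- Window bookkeeping for windows ending at `K ≥ K₀` (upper side): `Σ_{[k,k+n)} β⁰ ≤ (β′·log L + s)·n + R·N₀`
(`CapTailSlopeSandwich.beta0_windowSum_le_of_run`). [folklore] -/
theorem beta0_windowSum_le_fine {γs s : ℝ} {N₀ : ℕ} (hg : 0 < g) (hc : 0 < b * Real.log L)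
    (hR : RemainderConst S γ R) (hs : RemainderConst S γs s) (hγs : 0 < γs) (hN₀ : 1 ≤ b * Real.log L * N₀ * γs ^ 2)
    (hK : ∀ K : ℕ, K₀ ≤ K → ∃ g0 : ℝ, (C ⟨K, m, g0⟩).flow.InInterval γ K ∧ (C ⟨K, m, g0⟩).flow.g K = g ∧
      RGEqH K β (C ⟨K, m, g0⟩).flow.g ∧ ∀ k, k ≤ K →
        1 / g ^ 2 + b * (((K : ℝ) - k) * Real.log L) ≤ 1 / ((C ⟨K, m, g0⟩).flow.g k) ^ 2 ∧
        1 / ((C ⟨K, m, g0⟩).flow.g k) ^ 2 ≤ 1 / g ^ 2 + β' * (((K : ℝ) - k) * Real.log L))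
    {k n : ℕ} (hkn : K₀ ≤ k + n) :
    ∑ j ∈ Finset.Ico k (k + n), S.β0 j ≤ (β' * Real.log L + s) * n + R * N₀ := by
  obtain ⟨g0, hI, hend, hrg, hbounds⟩ := hK (k + n) hkn
  have hw := beta0_windowSum_le_of_run S (c' := β' * Real.log L) hc hrg hend hg hI hR hs hγs hN₀
    (fun j hj => by have := (hbounds j hj).1; linarith) (fun j hj => by have := (hbounds j hj).2; linarith)
    (Nat.le_add_right k n)
  have e : (((k + n : ℕ) : ℝ) - k) = n := by push_cast; ring
  rw [e] at hw
  exact hw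

end FixedData

/-! ## §2 Cesàro with a threshold; the tail-side necessities under the fine reading -/

/-- Cesàro with a threshold: `c·n − A ≤ Σ_{j<n} b_j` for all `n ≥ n₁` and `b → binf` force `c ≤ binf`. [folklore] -/
theorem le_lim_of_partialSum_lower_tendsto {b : ℕ → ℝ} {c A binf : ℝ} {n₁ : ℕ}
    (hw : ∀ n : ℕ, n₁ ≤ n → c * n - A ≤ ∑ j ∈ Finset.range n, b j) (hlim : Tendsto b atTop (𝓝 binf)) :
    c ≤ binf := by
  have hces := hlim.cesaro
  have hlow : Tendsto (fun n : ℕ => c - A * (n : ℝ)⁻¹) atTop (𝓝 c) := by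
    have h0 : Tendsto (fun n : ℕ => A * (n : ℝ)⁻¹) atTop (𝓝 0) := by
      simpa using tendsto_const_nhds.mul (tendsto_inv_atTop_nhds_zero_nat (𝕜 := ℝ))
    simpa using tendsto_const_nhds.sub h0
  refine le_of_tendsto_of_tendsto hlow hces ?_
  filter_upwards [eventually_ge_atTop (max 1 n₁)] with n hn
  have hn1 : 1 ≤ n := le_of_max_le_left hn
  have hn' : (0 : ℝ) < n := by exact_mod_cast hn1
  have h1 := hw n (le_of_max_le_right hn)
  rw [sub_le_iff_le_add]
  calc c = (n : ℝ)⁻¹ * (c * n) := by field_simp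
    _ ≤ (n : ℝ)⁻¹ * (∑ j ∈ Finset.range n, b j + A) :=
        mul_le_mul_of_nonneg_left (by linarith) (by positivity)
    _ = (n : ℝ)⁻¹ * ∑ i ∈ Finset.range n, b i + A * (n : ℝ)⁻¹ := by ring

/-- Upper mirror: `Σ_{j<n} b_j ≤ c·n + A` for all `n ≥ n₁` and `b → binf` force `binf ≤ c`. [folklore] -/
theorem lim_le_of_partialSum_upper_tendsto {b : ℕ → ℝ} {c A binf : ℝ} {n₁ : ℕ}
    (hw : ∀ n : ℕ, n₁ ≤ n → ∑ j ∈ Finset.range n, b j ≤ c * n + A) (hlim : Tendsto b atTop (𝓝 binf)) :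
    binf ≤ c := by
  have hw' : ∀ n : ℕ, n₁ ≤ n → (-c) * n - A ≤ ∑ j ∈ Finset.range n, (-b j) := by
    intro n hn
    rw [Finset.sum_neg_distrib]
    linarith [hw n hn]
  have := le_lim_of_partialSum_lower_tendsto hw' hlim.neg
  linarith

section Consequences

variable (S : B12Beta.OneLoopSplit β) {C : B12.Construction} {m K₀ : ℕ} {γ γc g b β' L R binf : ℝ}

/-- **THE SANDWICH UNDER THE FINE READING**: constants `0 < b`, `β′` realising (0.31) (with the recursion) on the lattices `K ≥ K₀` only, for a
split with `|β¹| ≤ R` on the run's box, `EverySlope`, and convergent `β⁰ → β⁰_∞`, satisfy `b·log L ≤ β⁰_∞ ≤ β′·log L` (`L > 1`).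
[cite: Balaban1987RG1, Thm 2 (0.31) p.259] -/
theorem slope_sandwich_binf_fine (hg : 0 < g) (hb : 0 < b) (hL : 1 < L) (hR : RemainderConst S γ R)
    (hrem : EverySlope S γc) (hlim : Tendsto S.β0 atTop (𝓝 binf))
    (hK : ∀ K : ℕ, K₀ ≤ K → ∃ g0 : ℝ, (C ⟨K, m, g0⟩).flow.InInterval γ K ∧ (C ⟨K, m, g0⟩).flow.g K = g ∧
      RGEqH K β (C ⟨K, m, g0⟩).flow.g ∧ ∀ k, k ≤ K →
        1 / g ^ 2 + b * (((K : ℝ) - k) * Real.log L) ≤ 1 / ((C ⟨K, m, g0⟩).flow.g k) ^ 2 ∧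
        1 / ((C ⟨K, m, g0⟩).flow.g k) ^ 2 ≤ 1 / g ^ 2 + β' * (((K : ℝ) - k) * Real.log L)) :
    b * Real.log L ≤ binf ∧ binf ≤ β' * Real.log L := by
  have hc : 0 < b * Real.log L := mul_pos hb (Real.log_pos hL)
  have hboth : ∀ s : ℝ, 0 < s → b * Real.log L - s ≤ binf ∧ binf ≤ β' * Real.log L + s := by
    intro s hs0
    obtain ⟨γs, hγs, -, hs⟩ := hrem s hs0
    set N₀ : ℕ := ⌈1 / (b * Real.log L * γs ^ 2)⌉₊ with hN₀_def
    have hN₀ : 1 ≤ b * Real.log L * N₀ * γs ^ 2 := by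
      have h1 : 1 / (b * Real.log L * γs ^ 2) ≤ N₀ := Nat.le_ceil _
      rw [div_le_iff₀ (by positivity)] at h1
      linarith
    have hlo : ∀ n : ℕ, K₀ ≤ n → (b * Real.log L - s) * n - R * N₀ ≤ ∑ j ∈ Finset.range n, S.β0 j := by
      intro n hn
      have h := beta0_windowSum_ge_fine S hg hc hR hs hγs hN₀ hK (k := 0) (n := n) (by simpa using hn)
      rw [zero_add, ← Finset.range_eq_Ico] at h
      exact h
    have hhi : ∀ n : ℕ, K₀ ≤ n → ∑ j ∈ Finset.range n, S.β0 j ≤ (β' * Real.log L + s) * n + R * N₀ := by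
      intro n hn
      have h := beta0_windowSum_le_fine S hg hc hR hs hγs hN₀ hK (k := 0) (n := n) (by simpa using hn)
      rw [zero_add, ← Finset.range_eq_Ico] at h
      exact h
    exact ⟨le_lim_of_partialSum_lower_tendsto hlo hlim, lim_le_of_partialSum_upper_tendsto hhi hlim⟩
  refine ⟨le_of_forall_pos_le_add fun s hs => ?_, le_of_forall_pos_le_add fun s hs => (hboth s hs).2⟩
  have := (hboth s hs).1
  linarith

/-- Hence under the fine reading a convergent one-loop sequence has `0 < β⁰_∞` and an eventual floor `β⁰_∞/2 ≤ β⁰_{k+1}` — the fine form of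
`CapTailLimitNecessary.eventualFloor_of_thm2Printed_tendsto`. [cite: Balaban1987RG1, Thm 2 (0.31) p.259] -/
theorem eventualFloor_fine_tendsto (hg : 0 < g) (hb : 0 < b) (hL : 1 < L) (hR : RemainderConst S γ R)
    (hrem : EverySlope S γc) (hlim : Tendsto S.β0 atTop (𝓝 binf))
    (hK : ∀ K : ℕ, K₀ ≤ K → ∃ g0 : ℝ, (C ⟨K, m, g0⟩).flow.InInterval γ K ∧ (C ⟨K, m, g0⟩).flow.g K = g ∧
      RGEqH K β (C ⟨K, m, g0⟩).flow.g ∧ ∀ k, k ≤ K →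
        1 / g ^ 2 + b * (((K : ℝ) - k) * Real.log L) ≤ 1 / ((C ⟨K, m, g0⟩).flow.g k) ^ 2 ∧
        1 / ((C ⟨K, m, g0⟩).flow.g k) ^ 2 ≤ 1 / g ^ 2 + β' * (((K : ℝ) - k) * Real.log L)) :
    0 < binf ∧ ∃ k₀ : ℕ, ∀ k, k₀ ≤ k → binf / 2 ≤ S.β0 k := by
  have hc : 0 < b * Real.log L := mul_pos hb (Real.log_pos hL)
  have hbinf : 0 < binf := hc.trans_le (slope_sandwich_binf_fine S hg hb hL hR hrem hlim hK).1
  have hev : ∀ᶠ k in atTop, S.β0 k ∈ Set.Ioi (binf / 2) := hlim.eventually (Ioi_mem_nhds (by linarith))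
  obtain ⟨k₀, hk₀⟩ := eventually_atTop.mp hev
  exact ⟨hbinf, k₀, fun k hk => (Set.mem_Ioi.mp (hk₀ k hk)).le⟩

/-- **THE PARTIAL SUMS OF β⁰ ARE UNBOUNDED under the fine reading** (`EverySlope`, `|β¹| ≤ R` on the run's box, `L > 1`). [cite: Balaban1987RG1, Thm 2 (0.31) p.259] -/
theorem partialSums_unbounded_fine (hg : 0 < g) (hb : 0 < b) (hL : 1 < L) (hR : RemainderConst S γ R) (hrem : EverySlope S γc)
    (hK : ∀ K : ℕ, K₀ ≤ K → ∃ g0 : ℝ, (C ⟨K, m, g0⟩).flow.InInterval γ K ∧ (C ⟨K, m, g0⟩).flow.g K = g ∧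
      RGEqH K β (C ⟨K, m, g0⟩).flow.g ∧ ∀ k, k ≤ K →
        1 / g ^ 2 + b * (((K : ℝ) - k) * Real.log L) ≤ 1 / ((C ⟨K, m, g0⟩).flow.g k) ^ 2 ∧
        1 / ((C ⟨K, m, g0⟩).flow.g k) ^ 2 ≤ 1 / g ^ 2 + β' * (((K : ℝ) - k) * Real.log L))
    (B : ℝ) : ¬ ∀ n : ℕ, ∑ j ∈ Finset.range n, S.β0 j ≤ B := by
  intro hB
  have hc : 0 < b * Real.log L := mul_pos hb (Real.log_pos hL)
  obtain ⟨γs, hγs, -, hs⟩ := hrem (b * Real.log L / 2) (by positivity)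
  set N₀ : ℕ := ⌈1 / (b * Real.log L * γs ^ 2)⌉₊ with hN₀_def
  have hN₀ : 1 ≤ b * Real.log L * N₀ * γs ^ 2 := by
    have h1 : 1 / (b * Real.log L * γs ^ 2) ≤ N₀ := Nat.le_ceil _
    rw [div_le_iff₀ (by positivity)] at h1
    linarith
  obtain ⟨n, hn⟩ := exists_nat_gt (max (K₀ : ℝ) ((R * N₀ + B) / (b * Real.log L / 2)))
  have hnK : K₀ ≤ n := by
    have : (K₀ : ℝ) < n := lt_of_le_of_lt (le_max_left _ _) hn
    exact_mod_cast this.le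
  have hw := beta0_windowSum_ge_fine S hg hc hR hs hγs hN₀ hK (k := 0) (n := n) (by simpa using hnK)
  rw [zero_add, ← Finset.range_eq_Ico] at hw
  have h2 := hB n
  have h3 : (R * N₀ + B) / (b * Real.log L / 2) < n := lt_of_le_of_lt (le_max_right _ _) hn
  rw [div_lt_iff₀ (by positivity)] at h3
  linarith

/-- **THE ABELIAN ONE-LOOP PART ADMITS NO FINE-LATTICE (0.31) EITHER** (cap3's `abelianCoeff`, partial sums `≤ 1/4`). [cite: Balaban1987RG1, Thm 2 (0.31) p.259] -/
theorem abelian_not_fine {La : ℕ} (hLa : La ≠ 0) (hS : ∀ k, S.β0 k = ((Beta.Certified.abelianCoeff La k : ℚ) : ℝ))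
    (hg : 0 < g) (hb : 0 < b) (hL : 1 < L) (hR : RemainderConst S γ R) (hrem : EverySlope S γc) :
    ¬ ∀ K : ℕ, K₀ ≤ K → ∃ g0 : ℝ, (C ⟨K, m, g0⟩).flow.InInterval γ K ∧ (C ⟨K, m, g0⟩).flow.g K = g ∧
      RGEqH K β (C ⟨K, m, g0⟩).flow.g ∧ ∀ k, k ≤ K →
        1 / g ^ 2 + b * (((K : ℝ) - k) * Real.log L) ≤ 1 / ((C ⟨K, m, g0⟩).flow.g k) ^ 2 ∧
        1 / ((C ⟨K, m, g0⟩).flow.g k) ^ 2 ≤ 1 / g ^ 2 + β' * (((K : ℝ) - k) * Real.log L) := by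
  intro hK
  refine partialSums_unbounded_fine S hg hb hL hR hrem hK (1 / 4) fun n => ?_
  have hq : ∑ j ∈ Finset.range n, S.β0 j = ((∑ j ∈ Finset.range n, Beta.Certified.abelianCoeff La j : ℚ) : ℝ) := by
    rw [Rat.cast_sum]; exact Finset.sum_congr rfl fun j _ => hS j
  rw [hq, Beta.Certified.sum_range_abelianCoeff hLa n]
  push_cast
  have : 0 ≤ 1 / (La : ℝ) ^ (4 * n) := by positivity
  linarith

end Consequences

end

end Summit.QuantumFields.BalabanUV.Gaps.CapSignsNecessaryFine
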